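import Literature.Analysis.FluidPDE.RestrictedEulerDynamics
import HarnessLib

/-!
# The strain-sector centre germ: discriminant in closed form (Negative lane, supports `RungBlowupCofinal` / BC5 rung 2)

Companion of `RungBlowupCofinal/Negative/AxisymmetricGermNotTriaxial.lean`.  In the half-turn cell at rung `2`, with
the doublet rotated to `q = 0` and no swirl at the centre (`B(0) = 0`, the «strain» sector of case Z2-HT), the centre
velocity gradient is the diagonal trace-free matrix

  `G(m, p) = !![3(m + p), 0, 0; 0, 3(m − p), 0; 0, 0, −6m]`  (`= 3𝒜(0)`),

its own strain germ, and the restricted-Euler discriminant of the germ is, in closed form,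

  `D = −729 · p² · (3m − p)² · (3m + p)²`.

Hence `D < 0` — three DISTINCT strain eigenvalues, the only way the half-turn rung's triaxiality letter
`IsTriaxial η G := 0 < tr(GᵀG) ∧ D(strain germ) ≤ −η·(tr GᵀG)³` can hold for some `η > 0` — iff `p ≠ 0` and
`p ≠ ±3m`, i.e. `|π₀| ∉ {0, 3|m₀|}` (PREREG-Z2-HT v1.1 §1 centre-germ letter); at `p = 0` (axis type) and at
`p = ±3m` (two coincident eigenvalues `3(m ∓ p) = −6m`… resp. `3(m ± p) = −6m`) the letter fails for every `η > 0`,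
and away from those three lines it holds with the explicit floor `η = 729 p²(3m − p)²(3m + p)² / (tr GᵀG)³`.

Nothing here asserts a Theses declaration.
-/

namespace Summit.NavierStokesRegularity.RungBlowupCofinalStrainSectorGerm

open Matrix Literature.Analysis.FluidPDE

/-- The strain-sector germ is trace-free. -/
theorem trace_strainSectorGerm (m p : ℝ) {G : Matrix (Fin 3) (Fin 3) ℝ}
    (hG : G = !![3 * (m + p), 0, 0; 0, 3 * (m - p), 0; 0, 0, -6 * m]) : G.trace = 0 := by
  subst hG
  rw [Matrix.trace_fin_three]
  simp
  ring

/-- The strain-sector germ is its own strain germ: `½(G + Gᵀ) − (tr G/3)·1 = diag(3(m+p), 3(m−p), −6m)`. -/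
theorem strainGerm_strainSector (m p : ℝ) {G : Matrix (Fin 3) (Fin 3) ℝ}
    (hG : G = !![3 * (m + p), 0, 0; 0, 3 * (m - p), 0; 0, 0, -6 * m]) :
    (1 / 2 : ℝ) • (G + Gᵀ) - (G.trace / 3) • (1 : Matrix (Fin 3) (Fin 3) ℝ) =
      Matrix.diagonal ![3 * (m + p), 3 * (m - p), -6 * m] := by
  rw [trace_strainSectorGerm m p hG, zero_div, zero_smul, sub_zero]
  subst hG
  ext i j
  simp only [Matrix.smul_apply, Matrix.add_apply, Matrix.transpose_apply, smul_eq_mul]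
  fin_cases i <;> fin_cases j <;> simp only [Fin.isValue, Fin.zero_eta, Fin.mk_one, Fin.reduceFinMk] <;> simp <;> ring

/-- **Closed form of the discriminant of the strain-sector germ**: `D = −729 p² (3m − p)² (3m + p)²`. -/
theorem discr_strainGerm_strainSector (m p : ℝ) {G : Matrix (Fin 3) (Fin 3) ℝ}
    (hG : G = !![3 * (m + p), 0, 0; 0, 3 * (m - p), 0; 0, 0, -6 * m]) :
    VelocityGradient.discr ((1 / 2 : ℝ) • (G + Gᵀ) - (G.trace / 3) • (1 : Matrix (Fin 3) (Fin 3) ℝ)) =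
      -729 * p ^ 2 * (3 * m - p) ^ 2 * (3 * m + p) ^ 2 := by
  rw [strainGerm_strainSector m p hG]
  have hl : (![3 * (m + p), 3 * (m - p), -6 * m] : Fin 3 → ℝ) 0 + (![3 * (m + p), 3 * (m - p), -6 * m] : Fin 3 → ℝ) 1 +
      (![3 * (m + p), 3 * (m - p), -6 * m] : Fin 3 → ℝ) 2 = 0 := by
    simp
    ring
  rw [VelocityGradient.discr_diagonal_fin_three _ hl]
  simp
  ring

/-- `tr(GᵀG) = 9(m+p)² + 9(m−p)² + 36m²` for the strain-sector germ. -/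
theorem trace_transpose_mul_strainSectorGerm (m p : ℝ) {G : Matrix (Fin 3) (Fin 3) ℝ}
    (hG : G = !![3 * (m + p), 0, 0; 0, 3 * (m - p), 0; 0, 0, -6 * m]) :
    (Gᵀ * G).trace = 9 * (m + p) ^ 2 + 9 * (m - p) ^ 2 + 36 * m ^ 2 := by
  subst hG
  rw [Matrix.trace_fin_three]
  simp [Matrix.mul_apply, Fin.sum_univ_three]
  ring

/-- **Degenerate doublet sizes never instance the letter**: at `p = 0` (axis type) or `p = ±3m` (two coincident
strain eigenvalues) the discriminant vanishes, so the triaxiality letter fails for every floor `η > 0` — the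
unfolded instance `¬ IsTriaxial η G`. -/
theorem not_triaxialLetter_strainSector_degenerate {η : ℝ} (hη : 0 < η) {m p : ℝ}
    (hp : p = 0 ∨ p = 3 * m ∨ p = -(3 * m)) {G : Matrix (Fin 3) (Fin 3) ℝ}
    (hG : G = !![3 * (m + p), 0, 0; 0, 3 * (m - p), 0; 0, 0, -6 * m]) :
    ¬ (0 < (Gᵀ * G).trace ∧
        VelocityGradient.discr ((1 / 2 : ℝ) • (G + Gᵀ) - (G.trace / 3) • (1 : Matrix (Fin 3) (Fin 3) ℝ)) ≤
          -η * ((Gᵀ * G).trace) ^ 3) := by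
  rintro ⟨hpos, hle⟩
  rw [discr_strainGerm_strainSector m p hG] at hle
  have h3 : 0 < ((Gᵀ * G).trace) ^ 3 := pow_pos hpos 3
  have hD : -729 * p ^ 2 * (3 * m - p) ^ 2 * (3 * m + p) ^ 2 = 0 := by
    rcases hp with h | h | h <;> subst h <;> ring
  rw [hD] at hle
  nlinarith

/-- **Away from the three degenerate lines the letter HOLDS with an explicit floor**: for `p ≠ 0`, `p ≠ ±3m`
the strain-sector germ satisfies the triaxiality letter with `η = 729 p²(3m − p)²(3m + p)² / (tr GᵀG)³ > 0` — the
unfolded instance `IsTriaxial η G`; so the «strain»/«full» census sectors are exactly where an instance shape for the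
rung's germ clause can come from. -/
theorem triaxialLetter_strainSector {m p : ℝ} (hp0 : p ≠ 0) (hp1 : p ≠ 3 * m) (hp2 : p ≠ -(3 * m))
    {G : Matrix (Fin 3) (Fin 3) ℝ} (hG : G = !![3 * (m + p), 0, 0; 0, 3 * (m - p), 0; 0, 0, -6 * m]) :
    ∃ η : ℝ, 0 < η ∧ (0 < (Gᵀ * G).trace ∧
        VelocityGradient.discr ((1 / 2 : ℝ) • (G + Gᵀ) - (G.trace / 3) • (1 : Matrix (Fin 3) (Fin 3) ℝ)) ≤
          -η * ((Gᵀ * G).trace) ^ 3) := by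
  have htr : 0 < (Gᵀ * G).trace := by
    rw [trace_transpose_mul_strainSectorGerm m p hG]
    have h1 : 0 < (m + p) ^ 2 ∨ 0 < (m - p) ^ 2 := by
      by_cases hm : m + p = 0
      · right
        have : m - p ≠ 0 := by
          intro h
          apply hp0
          linarith
        positivity
      · left
        positivity
    rcases h1 with h1 | h1 <;> nlinarith [sq_nonneg (m + p), sq_nonneg (m - p), sq_nonneg m]
  have hnum : 0 < 729 * p ^ 2 * (3 * m - p) ^ 2 * (3 * m + p) ^ 2 := by
    have ha : 0 < p ^ 2 := by positivity
    have hb : 0 < (3 * m - p) ^ 2 := by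
      have : 3 * m - p ≠ 0 := fun h => hp1 (by linarith)
      positivity
    have hc : 0 < (3 * m + p) ^ 2 := by
      have : 3 * m + p ≠ 0 := fun h => hp2 (by linarith)
      positivity
    positivity
  refine ⟨729 * p ^ 2 * (3 * m - p) ^ 2 * (3 * m + p) ^ 2 / ((Gᵀ * G).trace) ^ 3, by positivity, htr, ?_⟩
  rw [discr_strainGerm_strainSector m p hG]
  have h3 : 0 < ((Gᵀ * G).trace) ^ 3 := pow_pos htr 3
  have hc : 729 * p ^ 2 * (3 * m - p) ^ 2 * (3 * m + p) ^ 2 / ((Gᵀ * G).trace) ^ 3 * ((Gᵀ * G).trace) ^ 3 =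
      729 * p ^ 2 * (3 * m - p) ^ 2 * (3 * m + p) ^ 2 := div_mul_cancel₀ _ h3.ne'
  linarith [hc]

end Summit.NavierStokesRegularity.RungBlowupCofinalStrainSectorGerm
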